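/-
Copyright: lit-balaban cell, reader/typer seat r18 (gen 29).  Statement-level skeleton of a published paper; no proof claims beyond what
the kernel checks below.
-/
import Literature.MathematicalPhysics.QuantumFieldTheory.BalabanImbrieJaffe1984to88.BIJ88Sect3Statements

/-!
# `BalabanImbrieJaffe1984to88.BIJ88SmallFieldPredicatesAPI` — T. Bałaban, J. Imbrie, A. Jaffe, *Effective action and cluster properties
of the abelian Higgs model*, Commun. Math. Phys. **114** (1988) 257–315 [BalabanImbrieJaffe1988], p. 266 (`X*`, `X**`), p. 267 (3.15),
p. 270 (3.32)–(3.33): **the region calculus of the three typed small-field predicates** — monotonicity of `X*`, `X**` and of r18's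
`SmallField315` / `SmallBlock332` / `Small333` under SHRINKING THE REGION (print, p. 267: *"Later in this step we will introduce sets
Λ₁^{(0)}, Λ₂^{(0)}, etc., which are obtained from Λ₀^{(0)} either by deleting r(e₀)-cubes at the boundary of Λ₀^{(0)}, or by deleting
r(e₀)-cubes covering regions with "irrelevant" terms"*; p. 274: *"Λ_α^{(j)} ⊂ Λ_{α−1}^{(j)}"*), under ENLARGING THE CONSTANT `c`, and
**(3.33) AS ONE CONJUNCTION**: r18's `Small333 c p(e₀) Λ₇ A^{(0)} φ^{(0)}` assembled from its gauge-field half (proved on a bond set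
`Λ₁s ⊇ Λ₇*`, p27's `BIJ88Small333GaugeField` / `BIJ88Small333Regime`) and its scalar-field half (proved on the sites of `Λ₇`, p27's
`BIJ88Small333ScalarField`), with `c = max(c₁, c₂)`.

statement-level skeleton of published theorems with citation tags; proofs where landed; nothing here is a claim about the Yang–Mills mass gap

PDF held: `paper:balaban1988-cmp114-bij-abelian-higgs-effective-action` (journal page = PDF page + 256; pp. 266–267, 270 = PDF 10–11, 14;
text layer `p0013.txt`–`p0015.txt` re-read this session).

CITATION HEADER (lean-in-tree rule).  Part of the lit-balaban TYPED SKELETON (HOME `run/shared/lean/pub/lit-balaban/`), seat r18 gen 29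
(unit `lit-balaban-r18`, literature-prover-lit-balaban-r18-g29-0; C2 §§1–4 fold owner).  Rows served (CELLS only, heads unchanged — all three
are `proved`): `HOME/lit-balaban-r18/ROWS-C2.md` **C2.Eq3.15**, **C2.Eq3.32**, **C2.Eq3.33** (the ⟦SCOPE⟧ clause of C2.Eq3.33 records
*"`Small333` not one conjunction"*: the two halves of (3.33) were proved on different index sets — bonds of `Λ₁*` resp. sites of `Λ₇` — and
no theorem of the tree produced a term of r18's typed predicate `Small333 c pe₀ Λ A0 φ0` itself; `small333_of_halves` /
`small333_of_halves_subset` below do, from the two halves as hypotheses and print's nesting `Λ₇ ⊂ Λ₁`).  USED BY NAME: r18's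
`BIJ88Sect3Statements.starB` / `starP` / `mem_starB` / `SmallField315` / `SmallBlock332` / `Small333`.  Nothing is re-declared; in particular the
monotonicity of `X*` is NOT restated as a lemma (it is `BIJ88Eq564Torus.starB_mono` in the tree; the two-line argument is inlined where needed
to keep this file's imports at `BIJ88Sect3Statements` only).

WHAT IS PROVED (theorems only; 0 `sorry`; 0 definitions; no `Prop`-valued fact; standard axioms).
* §1 `mem_starP` (membership in `X**`), `starP_mono` (`X ⊆ Y ⟹ X** ⊆ Y**`).
* §2 `smallField315_mono` ((3.15) on `(Λ, Λ′)` ⟹ (3.15) on every `(Λ₁, Λ₁′)` with `Λ₁ ⊆ Λ`, `Λ₁′ ⊆ Λ′` — the four clauses live on `Λ*`,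
  `Λ′`, `Λ`, `Λ**`, all monotone), `smallBlock332_mono`, `smallBlock332_of_le` (constant `c ≤ c′`, for `0 ≤ e₀`, `0 ≤ p(e₀)`, `0 ≤ λ₀`),
  `small333_mono`, `small333_of_le`.
* §3 **`small333_of_halves`** (`Λ₇* ⊆ Λ₁s`, `|A^{(0)}_b| ≤ c₁p(e₀)` on `Λ₁s`, `‖φ^{(0)}(x)‖ ≤ c₂p(e₀)` on `Λ₇`, `0 ≤ p(e₀)` ⟹
  `Small333 (max c₁ c₂) p(e₀) Λ₇ A^{(0)} φ^{(0)}`) and **`small333_of_halves_subset`** (the same from print's nesting `Λ₇ ⊆ Λ₁` and the gauge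
  half on `Λ₁*`); projections `small333_abs_le` / `small333_norm_le`.
HONEST SCOPE.  Pure bookkeeping over r18's typed predicates: no analytic content, no new instance of (3.15)/(3.32)/(3.33) at the objects of
record (those are p30's / p27's / p29's files); the halves enter `small333_of_halves` as HYPOTHESES in exactly the shapes the tree proves them
(`∀ b ∈ Λ₁s, |A0 b| ≤ c₁ * pe₀`, `∀ x ∈ Λ₇, ‖φ0 x‖ ≤ c₂ * pe₀`).  Imports `BIJ88Sect3Statements` only.  NOT summit progress; NOT continuum;
NOT Clay.  Unit `lit-balaban-r18` (literature-prover-lit-balaban-r18-g29-0), 2026-08-23.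
-/

namespace Literature.MathematicalPhysics.QuantumFieldTheory.BalabanImbrieJaffe1984to88.BIJ88SmallFieldPredicatesAPI

open Literature.MathematicalPhysics.QuantumFieldTheory.Balaban1983to89
open BIJ88Sect3Statements (starB starP mem_starB SmallField315 SmallBlock332 Small333)

variable {P : Params} {j : ℕ}

/-! ## §1 The plaquette set `X**` -/

/-- kernel: membership in `X**` — p. 266 *"X** denotes the set of plaquettes with all four corners in X"*.
[cite: BalabanImbrieJaffe1988, (3.5) p.266] -/
theorem mem_starP (X : Finset (Balaban1983to89.Site P j)) (p : Plaq P j) :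
    p ∈ starP X ↔ p.src ∈ X ∧ p.src.shift p.μ ∈ X ∧ p.src.shift p.ν ∈ X ∧ (p.src.shift p.μ).shift p.ν ∈ X := by
  simp [starP]

/-- kernel: `X ⊆ Y ⟹ X** ⊆ Y**`. [cite: BalabanImbrieJaffe1988, (3.5) p.266] -/
theorem starP_mono {X Y : Finset (Balaban1983to89.Site P j)} (h : X ⊆ Y) : starP X ⊆ starP Y := by
  intro p hp
  rw [mem_starP] at hp ⊢
  exact ⟨h hp.1, h hp.2.1, h hp.2.2.1, h hp.2.2.2⟩

/-! ## §2 Monotonicity of the small-field predicates in the region and in the constant -/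

/-- **(3.15) restricts to sub-regions** (p. 267: the later regions *"Λ₁^{(0)}, Λ₂^{(0)}, etc., … are obtained from Λ₀^{(0)} … by deleting
r(e₀)-cubes"*): if the four small-field conditions hold on `(Λ, Λ′)` they hold on every `(Λ₁, Λ₁′)` with `Λ₁ ⊆ Λ`, `Λ₁′ ⊆ Λ′`.
[cite: BalabanImbrieJaffe1988, (3.15) p.267] -/
theorem smallField315_mono {pe₀ lam₀ : ℝ} {Λ Λ₁ : Finset (Balaban1983to89.Site P j)} {Λ' Λ₁' : Finset (Balaban1983to89.Site P (j + 1))}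
    {Dφ : PBond P j → ℂ} {ψ Qφ : Balaban1983to89.Site P (j + 1) → ℂ} {φ : Balaban1983to89.Site P j → ℂ} {f0 : Plaq P j → ℝ}
    (h : SmallField315 pe₀ lam₀ Λ Λ' Dφ ψ Qφ φ f0) (hΛ : Λ₁ ⊆ Λ) (hΛ' : Λ₁' ⊆ Λ') :
    SmallField315 pe₀ lam₀ Λ₁ Λ₁' Dφ ψ Qφ φ f0 := by
  obtain ⟨hD, hQ, hφ, hf⟩ := h
  refine ⟨fun b hb => hD b ?_, fun y hy => hQ y (hΛ' hy), fun x hx => hφ x (hΛ hx), fun p hp => hf p (starP_mono hΛ hp)⟩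
  rw [mem_starB] at hb ⊢
  exact ⟨hΛ hb.1, hΛ hb.2⟩

/-- **(3.32) restricts to sub-regions of the block lattice.** [cite: BalabanImbrieJaffe1988, (3.32) p.270] -/
theorem smallBlock332_mono {c e₀ pe₀ lam₀ : ℝ} {Λ' Λ₁' : Finset (Balaban1983to89.Site P (j + 1))} {v : Plaq P (j + 1) → ℂ}
    {ψ : Balaban1983to89.Site P (j + 1) → ℂ} {Dψ : PBond P (j + 1) → ℂ}
    (h : SmallBlock332 c e₀ pe₀ lam₀ Λ' v ψ Dψ) (hΛ' : Λ₁' ⊆ Λ') : SmallBlock332 c e₀ pe₀ lam₀ Λ₁' v ψ Dψ := by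
  obtain ⟨hv, hψ, hD⟩ := h
  refine ⟨fun p hp => hv p (starP_mono hΛ' hp), fun y hy => hψ y (hΛ' hy), fun b hb => hD b ?_⟩
  rw [mem_starB] at hb ⊢
  exact ⟨hΛ' hb.1, hΛ' hb.2⟩

/-- **(3.32) with a larger constant**: `c ≤ c′` (for `0 ≤ e₀`, `0 ≤ p(e₀)`, `0 ≤ λ₀`). [cite: BalabanImbrieJaffe1988, (3.32) p.270] -/
theorem smallBlock332_of_le {c c' e₀ pe₀ lam₀ : ℝ} {Λ' : Finset (Balaban1983to89.Site P (j + 1))} {v : Plaq P (j + 1) → ℂ}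
    {ψ : Balaban1983to89.Site P (j + 1) → ℂ} {Dψ : PBond P (j + 1) → ℂ}
    (h : SmallBlock332 c e₀ pe₀ lam₀ Λ' v ψ Dψ) (hc : c ≤ c') (he : 0 ≤ e₀) (hpe : 0 ≤ pe₀) (hlam : 0 ≤ lam₀) :
    SmallBlock332 c' e₀ pe₀ lam₀ Λ' v ψ Dψ := by
  obtain ⟨hv, hψ, hD⟩ := h
  have hl : 0 ≤ lam₀ ^ (-(1 / 4 : ℝ)) := Real.rpow_nonneg hlam _
  refine ⟨fun p hp => (hv p hp).trans ?_, fun y hy => (hψ y hy).trans ?_, fun b hb => (hD b hb).trans ?_⟩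
  · exact mul_le_mul_of_nonneg_right (mul_le_mul_of_nonneg_right hc he) hpe
  · exact mul_le_mul_of_nonneg_right (mul_le_mul_of_nonneg_right hc hpe) hl
  · exact mul_le_mul_of_nonneg_right hc hpe

/-- **(3.33) restricts to sub-regions** (print: the factor `χ′_{Λ₇^{(0)}}` enforces the bounds in `Λ₇^{(0)} ⊂ Λ₁^{(0)}`).
[cite: BalabanImbrieJaffe1988, (3.33) p.270] -/
theorem small333_mono {c pe₀ : ℝ} {Λ Λ₁ : Finset (Balaban1983to89.Site P j)} {A0 : PBond P j → ℝ}
    {φ0 : Balaban1983to89.Site P j → ℂ} (h : Small333 c pe₀ Λ A0 φ0) (hΛ : Λ₁ ⊆ Λ) : Small333 c pe₀ Λ₁ A0 φ0 := by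
  obtain ⟨hA, hφ⟩ := h
  refine ⟨fun b hb => hA b ?_, fun x hx => hφ x (hΛ hx)⟩
  rw [mem_starB] at hb ⊢
  exact ⟨hΛ hb.1, hΛ hb.2⟩

/-- **(3.33) with a larger constant**: `c ≤ c′` (for `0 ≤ p(e₀)`). [cite: BalabanImbrieJaffe1988, (3.33) p.270] -/
theorem small333_of_le {c c' pe₀ : ℝ} {Λ : Finset (Balaban1983to89.Site P j)} {A0 : PBond P j → ℝ}
    {φ0 : Balaban1983to89.Site P j → ℂ} (h : Small333 c pe₀ Λ A0 φ0) (hc : c ≤ c') (hpe : 0 ≤ pe₀) :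
    Small333 c' pe₀ Λ A0 φ0 :=
  ⟨fun b hb => (h.1 b hb).trans (mul_le_mul_of_nonneg_right hc hpe),
    fun x hx => (h.2 x hx).trans (mul_le_mul_of_nonneg_right hc hpe)⟩

/-- projection: the gauge-field clause of (3.33). [cite: BalabanImbrieJaffe1988, (3.33) p.270] -/
theorem small333_abs_le {c pe₀ : ℝ} {Λ : Finset (Balaban1983to89.Site P j)} {A0 : PBond P j → ℝ}
    {φ0 : Balaban1983to89.Site P j → ℂ} (h : Small333 c pe₀ Λ A0 φ0) : ∀ b ∈ starB Λ, |A0 b| ≤ c * pe₀ := h.1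

/-- projection: the scalar-field clause of (3.33). [cite: BalabanImbrieJaffe1988, (3.33) p.270] -/
theorem small333_norm_le {c pe₀ : ℝ} {Λ : Finset (Balaban1983to89.Site P j)} {A0 : PBond P j → ℝ}
    {φ0 : Balaban1983to89.Site P j → ℂ} (h : Small333 c pe₀ Λ A0 φ0) : ∀ x ∈ Λ, ‖φ0 x‖ ≤ c * pe₀ := h.2

/-! ## §3 (3.33) as ONE conjunction from its two halves -/

/-- **(3.33) AS ONE CONJUNCTION** — p. 270: *"Similarly, it can be shown that |A^{(0)}| ≦ cp(e₀) in Λ₁^{(0)*}, |φ^{(0)}| ≦ cp(e₀) in Λ₁^{(0)*} [sic],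
(3.33) and we inse[r]t a factor χ′_{Λ₇^{(0)}} enforcing these bounds in Λ₇^{(0)}"*: if the gauge-field half holds on a bond set `Λ₁s ⊇ Λ₇*` with
constant `c₁` (the shape of p27's `BIJ88Small333GaugeField.small333_gauge` / `BIJ88Small333Regime.small333_gauge_of_smallField315_collar_regime`)
and the scalar-field half holds on the sites of `Λ₇` with constant `c₂` (the shape of p27's `BIJ88Small333ScalarField.small333_scalar_of_smallField315_at_u`
/ p29's `BIJ88ScalarTranslation330Size.small333_scalar_corr330_smallField`), then r18's typed predicate holds on `Λ₇` with `c = max(c₁, c₂)`.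
[cite: BalabanImbrieJaffe1988, (3.33) p.270] -/
theorem small333_of_halves {c₁ c₂ pe₀ : ℝ} {Λ₇ : Finset (Balaban1983to89.Site P j)} {Λ₁s : Finset (PBond P j)} {A0 : PBond P j → ℝ}
    {φ0 : Balaban1983to89.Site P j → ℂ} (hpe : 0 ≤ pe₀) (hsub : starB Λ₇ ⊆ Λ₁s)
    (hA : ∀ b ∈ Λ₁s, |A0 b| ≤ c₁ * pe₀) (hφ : ∀ x ∈ Λ₇, ‖φ0 x‖ ≤ c₂ * pe₀) :
    Small333 (max c₁ c₂) pe₀ Λ₇ A0 φ0 :=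
  ⟨fun b hb => (hA b (hsub hb)).trans (mul_le_mul_of_nonneg_right (le_max_left _ _) hpe),
    fun x hx => (hφ x hx).trans (mul_le_mul_of_nonneg_right (le_max_right _ _) hpe)⟩

/-- **(3.33) AS ONE CONJUNCTION, with print's nesting `Λ₇^{(0)} ⊂ Λ₁^{(0)}`**: the gauge half on `Λ₁*` and the scalar half on `Λ₇ ⊆ Λ₁` give
r18's `Small333 (max c₁ c₂) p(e₀) Λ₇ A^{(0)} φ^{(0)}`. [cite: BalabanImbrieJaffe1988, (3.33) p.270] -/
theorem small333_of_halves_subset {c₁ c₂ pe₀ : ℝ} {Λ₁ Λ₇ : Finset (Balaban1983to89.Site P j)} {A0 : PBond P j → ℝ}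
    {φ0 : Balaban1983to89.Site P j → ℂ} (hpe : 0 ≤ pe₀) (h71 : Λ₇ ⊆ Λ₁)
    (hA : ∀ b ∈ starB Λ₁, |A0 b| ≤ c₁ * pe₀) (hφ : ∀ x ∈ Λ₇, ‖φ0 x‖ ≤ c₂ * pe₀) :
    Small333 (max c₁ c₂) pe₀ Λ₇ A0 φ0 := by
  refine small333_of_halves hpe (fun b hb => ?_) hA hφ
  rw [mem_starB] at hb ⊢
  exact ⟨h71 hb.1, h71 hb.2⟩

end Literature.MathematicalPhysics.QuantumFieldTheory.BalabanImbrieJaffe1984to88.BIJ88SmallFieldPredicatesAPI
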